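import Mathlib
import HarnessLib
import Summits.HubbardSuperconductivity.HubbardSuperconductivity.Theorems.KLProgrammeKLRegimeEngineLastStepTwoLegReadOfPos
import Summits.HubbardSuperconductivity.HubbardSuperconductivity.Theorems.KLProgrammeKLRegimeFlowReadTransportOneCall

/-!
# K3 gen-8-FLOW (stmt 20437, stub (C), located item #20 cure (δ′) ∘ «(C2)-ONE-CALL»): THE LAST-INDEX TWO-LEG READING, ONE CALL, with the (T) TRANSPORT bracket
# ALSO discharged by name — `twoLegRead_flow_last_registered_of_pos_c2` (cell gate-hubbard-kl, seat p2 g23)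

= p2 g21's `twoLegRead_flow_last_registered_of_pos` (p649639: k3c3-p1's (P)-receiver `twoLegRead_flow_succ_of_swap_lit_registered` at `n := n_β` ∘ the (δ′) response door in
position currency ∘ the margin lemmas) ∘ `transport_last_flow_fit_of_spaceMoments` (…FlowReadTransportOneCall) at `n := n_β`: the (T) pair `(hTrdiff, hTr)` is produced
inside from the SAME flow history `hPh/hT` (frame jets of `K_{n_β}` to order five, cutoff table `klChi2CauchyTab2 4` = the (δ′) door's, so the SAME `W`), ONE more E1 export —
the rev-14 #17 string (ii) at the last index `TwoLegDualSpaceMomentsUpToAt L M (klZspLaw z U (n_β+1)) β U μ (n_β+1) 5` — and the admissibility of `K_{n_β+1}` at depth `n_β`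
(`frameOK_klFlowFrameU_succ` of the history).  E1 side now: the four β-free constants `cb cbs cc ccs` of p649639, `z` (#17), five (T) rows `aF_j + 2·4^{j−1}·z j ≤ mT j`
and a primed table `eT′ ≥` `transport_jets_flow_fit`'s table in `mT` (entrywise, `k ≤ 4`); the closer-side brackets left are (A)-OLD-FRAME `hA/hAval` (c4a-1) and (C1)
`hJ/hJdiff` (`eJ 0 = 0`), with the fits `cA k + ((0|1) + eJ k) ≤ klC4aJetC2 k`, `cA′ k + ((1|0) + eT′ k + eJ′ k) ≤ klC4aJetC′ P R k`, `2·(a + (1 + eT′ 0 + eJ′ 0)) ≤ klReadOscC P R`.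

* **`twoLegRead_flow_last_registered_of_pos_c2`**.

Composition only; no definitions; nothing asserts superconductivity.  Refs: BGM 2006 §2.4 Lemma 2.1 (2.36)–(2.42) [cite: BenfattoGiulianiMastropietro2006];
FST 1996 §1 [cite: FeldmanSalmhoferTrubowitz1996].
-/

noncomputable section

namespace Summit.HubbardSuperconductivity.HubbardSuperconductivity.Theorems.EngineV8

set_option linter.dupNamespace false -- summit = problem name (single-conjunct summit), D-0017
set_option exponentiation.threshold 512 -- the graded alias-tail constant is `2^282`

open Complex Real Finset Filter Literature.MathematicalPhysics.QuantumLattice Literature.Probability.LatticeModels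
open Literature.MathematicalPhysics.QuantumLattice.BandSectorCounting
open Literature.Analysis.Fourier Literature.Analysis.Calculus
open Summit.HubbardSuperconductivity.HubbardSuperconductivity.Theorems.KLRegimeSplit
open Summit.HubbardSuperconductivity.HubbardSuperconductivity.Theorems.DispersionFlow
open Summit.HubbardSuperconductivity.HubbardSuperconductivity.Theorems.KLProgrammeLegKernels
open Summit.HubbardSuperconductivity.HubbardSuperconductivity.Theorems.PerturbedFermiCurve
open scoped Nat

section LastOfPosC2

variable {L M : ℕ} [NeZero L] [NeZero M]

/-- **THE LAST-INDEX REGISTERED TWO-LEG PAIR, ONE CALL, (R) AND (T) DISCHARGED BY NAME** — see the module docstring.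
[cite: BenfattoGiulianiMastropietro2006, §2.4 Lemma 2.1 (2.36)–(2.42)] -/
theorem twoLegRead_flow_last_registered_of_pos_c2 {R : RenConsts} (hR : ∀ j, 0 ≤ R.Gfr j) {c : ℝ} (hc : 0 < c) (hcle : c ≤ klCurveC3 R)
    {U : ℝ} (hU : 0 < U) (hU1 : U ≤ 1) (hUle : U ≤ klCurveU0 R) {β : ℝ} (hβmin : klBetaMin ≤ β) (hβc : β ≤ Real.exp (c / U ^ 2))
    {μ : ℝ} (hμ : μ ∈ klWindowC) (hK : FrameOK R U (nScales β) μ (klFlowFrameU L M β U μ (nScales β)))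
    (hK1 : FrameOK R U (nScales β) μ (klFlowFrameU L M β U μ (nScales β + 1))) {G : GeoConsts} {Q : EngConsts} (hGS : ∀ k, 0 ≤ G.S k) (hQS : ∀ k, 0 ≤ Q.S' k) (hR0 : 0 < R.Gfr 0)
    (hPh : ∀ m ≤ nScales β, FlowPieceJetsAt L M β U μ R m) (hT : ∀ m ≤ nScales β, TwoLegReadJetsF L M G Q β U μ m) {W Ξ Θ : ℝ}
    (hW : W = curveExtC (klChi2CauchyTab2 4) G.S 1 + curveExtC (klChi2CauchyTab2 4) Q.S' 1 * |U|) (hΞ : Ξ = 2 ^ 10 * (1 + Real.pi ^ 8 * (W * U ^ 2) / 2 ^ 11) + ∑ j ∈ range 5, R.Gfr j)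
    (hΘ : Θ = 1 + ((∑ j ∈ range 5, R.Gfr j) + Real.pi ^ 8 * W / 2 ^ 11) * |U| / R.Gfr 0)
    (hdoor : R.Gfr 0 * |U| + ((∑ j ∈ range 5, R.Gfr j) + Real.pi ^ 8 * W / 2 ^ 11) * U ^ 2 ≤ 1 / 512) {P : SplitConsts} (hL : klEngL₄ P R β U ≤ L)
    (hZn : IsUnit (effPartitionFn ℂ (normalCovariance L M (uvSymbolCT L M β μ (klFlowFrameU L M β U μ (nScales β + 1)) (klScale klE0 (nScales β + 1))))
      (hubbardInteraction L M β U + counterQuadratic L M β (klFlowFrameU L M β U μ (nScales β + 1)))))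
    {s : ℕ} (hs : 10 ≤ s)
    {cb cbs cc ccs : ℝ} (hcb : 0 ≤ cb) (hcbs : 0 ≤ cbs) (hcc : 0 ≤ cc) (hccs : 0 ≤ ccs)
    (hSb : ∀ m ≤ 4, ∀ (σ : Fin 2) (x₀ : SpaceTimeIdx L M), imagTimeWeight β M *
      ∑ x ∈ (univ : Finset (Fin 2 → SpaceTimeIdx L M)).filter (fun x => x 0 = x₀),
        (1 + ((((x 1).2 - (x 0).2) 0).valMinAbs.natAbs : ℝ) + ((((x 1).2 - (x 0).2) 1).valMinAbs.natAbs : ℝ)) ^ m *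
          ‖sectorisedKernel L M β (trivialMultiplier L M) (klEffectiveAction L M β U μ (klFlowFrameU L M β U μ (nScales β + 1)) klE0 (nScales β + 1)) 2
            (![((0, σ), 0), ((0, σ), 1)] : Fin 2 → SectorLeg 1) x‖ ≤ cb * U * ((4 : ℝ) ^ nScales β) ^ m)
    (hSbs : ∀ (σ : Fin 2) (x₀ : SpaceTimeIdx L M), imagTimeWeight β M *
      ∑ x ∈ (univ : Finset (Fin 2 → SpaceTimeIdx L M)).filter (fun x => x 0 = x₀),
        (1 + ((((x 1).2 - (x 0).2) 0).valMinAbs.natAbs : ℝ) + ((((x 1).2 - (x 0).2) 1).valMinAbs.natAbs : ℝ)) ^ s *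
          ‖sectorisedKernel L M β (trivialMultiplier L M) (klEffectiveAction L M β U μ (klFlowFrameU L M β U μ (nScales β + 1)) klE0 (nScales β + 1)) 2
            (![((0, σ), 0), ((0, σ), 1)] : Fin 2 → SectorLeg 1) x‖ ≤ cbs * U * ((4 : ℝ) ^ nScales β) ^ s)
    (hTc : ∀ m ≤ 4, ∀ (σ : Fin 2) (x₀ : SpaceTimeIdx L M), imagTimeWeight β M *
      ∑ x ∈ (univ : Finset (Fin 2 → SpaceTimeIdx L M)).filter (fun x => x 0 = x₀),
        (1 + ((((x 1).2 - (x 0).2) 0).valMinAbs.natAbs : ℝ) + ((((x 1).2 - (x 0).2) 1).valMinAbs.natAbs : ℝ)) ^ m * (imagTimeWeight β M * (circDist (2 * M) (x 0).1.val (x 1).1.val : ℝ)) *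
          ‖sectorisedKernel L M β (trivialMultiplier L M) (klEffectiveAction L M β U μ (klFlowFrameU L M β U μ (nScales β + 1)) klE0 (nScales β + 1)) 2
            (![((0, σ), 0), ((0, σ), 1)] : Fin 2 → SectorLeg 1) x‖ ≤ cc * U ^ 2 * ((4 : ℝ) ^ nScales β) ^ m)
    (hTcs : ∀ (σ : Fin 2) (x₀ : SpaceTimeIdx L M), imagTimeWeight β M *
      ∑ x ∈ (univ : Finset (Fin 2 → SpaceTimeIdx L M)).filter (fun x => x 0 = x₀),
        (1 + ((((x 1).2 - (x 0).2) 0).valMinAbs.natAbs : ℝ) + ((((x 1).2 - (x 0).2) 1).valMinAbs.natAbs : ℝ)) ^ s * (imagTimeWeight β M * (circDist (2 * M) (x 0).1.val (x 1).1.val : ℝ)) *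
          ‖sectorisedKernel L M β (trivialMultiplier L M) (klEffectiveAction L M β U μ (klFlowFrameU L M β U μ (nScales β + 1)) klE0 (nScales β + 1)) 2
            (![((0, σ), 0), ((0, σ), 1)] : Fin 2 → SectorLeg 1) x‖ ≤ ccs * U ^ 2 * ((4 : ℝ) ^ nScales β) ^ s)
    (hUlast : U ≤ klLastRespU P R) (hUE1 : 32 * klEngRsq R ^ 5 * (2 ^ 234 * cb + 2 ^ 156 * cc + cbs + ccs) * U ≤ 1)
    -- the (P)-receiver's other inputs at the last index (k3c3-p1 `twoLegRead_flow_succ_of_swap_lit_registered`, n := n_β)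
    (hLdeg : 4 * klFlowDeg (nScales β + 1) ≤ L) {cA cA' eJ eJ' : ℕ → ℝ} {τA a : ℝ}
    (hA : TwoLegCurveJetBound L M cA cA' β U μ (klFlowFrameU L M β U μ (nScales β)) (nScales β + 1))
    (hAval : ∀ θ : ℝ, |klTwoLegCurveProfile L M β U μ (klFlowFrameU L M β U μ (nScales β)) (nScales β + 1) θ - τA| ≤
      a * U ^ 2 * (4 : ℝ) ^ (-2 * ((nScales β + 1 : ℕ) : ℤ)))
    -- (T): the #17 export at the LAST index `(K_{n_β+1}, n_β+1)`, five rows (factor `4^{j−1}`), a primed table above `transport_jets_flow_fit`'s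
    {z : ℕ → ℝ} (hz : ∀ j, 0 ≤ z j) (hZsp : TwoLegDualSpaceMomentsUpToAt L M (klZspLaw z U (nScales β + 1)) β U μ (nScales β + 1) 5)
    {mT : ℕ → ℝ} (hmT : ∀ j, 0 ≤ mT j)
    (hmT1 : 4 / 3 * R.Gfr 1 + 2 * z 1 ≤ mT 1) (hmT2 : R.Gfr 2 + 8 * z 2 ≤ mT 2) (hmT3 : R.Gfr 3 / 3 + 32 * z 3 ≤ mT 3)
    (hmT4 : R.Gfr 4 / 15 + 128 * z 4 ≤ mT 4) (hmT5 : 2 ^ 5 * (Real.pi ^ 8 / 4 * 2 ^ 4 * (2 : ℝ) ^ 32) * W / 63 + 512 * z 5 ≤ mT 5)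
    {eT' : ℕ → ℝ} (heT : ∀ k ≤ 4,
        (fun k : ℕ =>
          if k = 0 then 16 * ((12.2 * R.Gfr 0 * mT 1))
          else if k = 1 then 4 * ((1420 * 2 * (R.Gfr 1 + R.Gfr 2 + R.Gfr 3 + R.Gfr 4) * (1 + 2 * (R.Gfr 3 + R.Gfr 4)) * mT 1) + (36400 * R.Gfr 0 * mT 1) + (2820 * R.Gfr 0 * mT 2))
          else if k = 2 then ((12900000 * 2 ^ 2 * (R.Gfr 1 + R.Gfr 2 + R.Gfr 3 + R.Gfr 4) * (1 + 2 * (R.Gfr 3 + R.Gfr 4)) ^ 2 * mT 1) + (657000 * 2 * (R.Gfr 1 + R.Gfr 2 + R.Gfr 3 + R.Gfr 4) * (1 + 2 * (R.Gfr 3 + R.Gfr 4)) * mT 2) + (338000000 * 2 * R.Gfr 0 * (1 + 2 * (R.Gfr 3 + R.Gfr 4)) * mT 1) + (25400000 * R.Gfr 0 * mT 2) + (652000 * R.Gfr 0 * mT 3))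
          else if k = 3 then ((199000000000 * 2 ^ 3 * (R.Gfr 1 + R.Gfr 2 + R.Gfr 3 + R.Gfr 4) * (1 + 2 * (R.Gfr 3 + R.Gfr 4)) ^ 3 * mT 1) + (12000000000 * 2 ^ 2 * (R.Gfr 1 + R.Gfr 2 + R.Gfr 3 + R.Gfr 4) * (1 + 2 * (R.Gfr 3 + R.Gfr 4)) ^ 2 * mT 2) + (228000000 * 2 * (R.Gfr 1 + R.Gfr 2 + R.Gfr 3 + R.Gfr 4) * (1 + 2 * (R.Gfr 3 + R.Gfr 4)) * mT 3) + (5230000000000 * 2 ^ 2 * R.Gfr 0 * (1 + 2 * (R.Gfr 3 + R.Gfr 4)) ^ 2 * mT 1) + (392000000000 * 2 * R.Gfr 0 * (1 + 2 * (R.Gfr 3 + R.Gfr 4)) * mT 2) + (11800000000 * R.Gfr 0 * mT 3) + (151000000 * R.Gfr 0 * mT 4)) / 4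
          else if k = 4 then ((4300000000000000 * 2 ^ 4 * (R.Gfr 1 + R.Gfr 2 + R.Gfr 3 + R.Gfr 4) * (1 + 2 * (R.Gfr 3 + R.Gfr 4)) ^ 4 * mT 1) + (276000000000000 * 2 ^ 3 * (R.Gfr 1 + R.Gfr 2 + R.Gfr 3 + R.Gfr 4) * (1 + 2 * (R.Gfr 3 + R.Gfr 4)) ^ 3 * mT 2) + (6890000000000 * 2 ^ 2 * (R.Gfr 1 + R.Gfr 2 + R.Gfr 3 + R.Gfr 4) * (1 + 2 * (R.Gfr 3 + R.Gfr 4)) ^ 2 * mT 3) + (70100000000 * 2 * (R.Gfr 1 + R.Gfr 2 + R.Gfr 3 + R.Gfr 4) * (1 + 2 * (R.Gfr 3 + R.Gfr 4)) * mT 4) + (114000000000000000 * 2 ^ 2 * R.Gfr 0 * (1 + 2 * (R.Gfr 3 + R.Gfr 4)) ^ 2 * mT 1) + (8490000000000000 * 2 ^ 2 * R.Gfr 0 * (1 + 2 * (R.Gfr 3 + R.Gfr 4)) ^ 2 * mT 2) + (272000000000000 * 2 * R.Gfr 0 * (1 + 2 * (R.Gfr 3 + R.Gfr 4)) * mT 3)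 + (4530000000000 * R.Gfr 0 * mT 4) + (34800000000 * R.Gfr 0 * mT 5) + (69200000000 * (16 / 15) * R.Gfr 4 * mT 1)) / 16
          else 0) k ≤ eT' k)
    (hJdiff : ContDiff ℝ 4 fun θ : ℝ => klLocalPart L M β U μ (klFlowFrameU L M β U μ (nScales β)) (nScales β) θ -
      (klFlowPiece L M β U μ (nScales β)).eval (klFermiPoint μ (klFlowFrameU L M β U μ (nScales β + 1)) θ))
    (hJ : ∀ k ≤ 4, ∀ θ : ℝ, |iteratedDeriv k (fun θ : ℝ => klLocalPart L M β U μ (klFlowFrameU L M β U μ (nScales β)) (nScales β) θ -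
      (klFlowPiece L M β U μ (nScales β)).eval (klFermiPoint μ (klFlowFrameU L M β U μ (nScales β + 1)) θ)) θ| ≤ curveJetBar eJ eJ' U k (nScales β + 1))
    (heJ0 : eJ 0 = 0)
    (hfit : ∀ k, cA k + ((if k = 0 then (0 : ℝ) else 1) + eJ k) ≤ klC4aJetC2 k)
    (hfit' : ∀ k, cA' k + ((if k = 0 then (1 : ℝ) else 0) + eT' k + eJ' k) ≤ klC4aJetC' P R k)
    (hfitO : 2 * (a + (1 + eT' 0 + eJ' 0)) ≤ klReadOscC P R) :
    TwoLegReadJetBound L M klC4aJetC2 (klC4aJetC' P R) β U μ (klFlowFrameU L M β U μ (nScales β + 1)) (nScales β + 1) ∧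
      TwoLegReadOscAt L M (klReadOscC P R) β U μ (klFlowFrameU L M β U μ (nScales β + 1)) (nScales β + 1) := by
  obtain ⟨hTrdiff, hTr⟩ := transport_last_flow_fit_of_spaceMoments (L := L) (M := M) hR hGS hQS hc hcle hU hUle hβmin hβc hμ le_rfl hK hK1
    (salmhoferCutoff_flat_cauchy_table2 4) hPh hT le_rfl hLdeg hmT hz hZsp hmT1 hmT2 hmT3 hmT4 (by rw [hW] at hmT5; exact hmT5) heT
  have hfit2 : ∀ k, cA k + ((if k = 0 then (0 : ℝ) else 1) + (fun _ : ℕ => (0 : ℝ)) k + eJ k) ≤ klC4aJetC2 k := fun k => by simpa using hfit k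
  exact twoLegRead_flow_last_registered_of_pos hR hc hcle hU hU1 hUle hβmin hβc hμ hK hGS hQS hR0 hPh hT hW hΞ hΘ hdoor hL hZn hs hcb hcbs hcc hccs hSb hSbs
    hTc hTcs hUlast hUE1 hLdeg hA hAval hTrdiff hTr hJdiff hJ rfl heJ0 hfit2 hfit' hfitO

end LastOfPosC2

end Summit.HubbardSuperconductivity.HubbardSuperconductivity.Theorems.EngineV8

end
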